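import Mathlib
import HarnessLib
import HarnessLib.Audit
import Summits.AtomisticToContinuum.Statement
import Literature.MathematicalPhysics.QuantumManyBody.PeriodicBoseGas
import HarnessLib.Audit.Status.Attr

/-!
Route: BECBathMassLiouville

DORMANT since 2026-08-24T23:41:29Z (reconciler: no traction for 7.2 d (last activity item-evidence-added at 2026-08-17T18:55:01Z); parked, not closed — `ledger route dormant route-AtomisticToContinuum-BECBathMassLiouville --off` to reac) — unstaffed, not closed; items shared with open routes are served there. `ledger route dormant <id> --off` reactivates.

# Route BECBathMassLiouville — bath-mass dial — torus BEC as space-time delocalisation of the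
inserted boson, a Liouville theorem from a density-response bound, frozen (no BEC) and light-bath
(coherent) endpoints

It suffices to show X = InsertionResidue (card frozen-bath-anderson-endpoint, its η = 1 statement
typed): for every repulsive
finite-range v there is ρ₀ > 0 such that for 0 < ρ < ρ₀ there is c > 0 with: for all large N there
is δ > 0 such that every
δ-near-minimiser Θ of the periodic N-body energy and every δ-near-minimiser Ψ of the periodic
(N+1)-body energy on the same torus of
side L = ((N+1)/ρ)^(1/3) satisfy |⟨φ₀ ⊗ Θ, Ψ⟩|² = L⁻³|∫ conj Θ(X) ∫ Ψ(x,X) dx dX|² ≥ c (φ₀ the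
constant mode). For the true ground
states this is Z_N = (E h)²/E h² ≥ c for the insertion amplitude h = Ψ_(N+1)/Ψ_N > 0, i.e. the
card's claim that the principal
eigenfunction of the tagged boson in the space-time random medium generated by the recoiling bath is
EXTENDED (flat in L²(|Ψ_N|²dX⊗dy)-mean):
T = 0 condensation as many-body anti-localisation. X ⇒ constant-mode BEC of periodic near-minimisers
(support ResidueCondensesAll,
Cauchy–Schwarz) ⇒ the Dirichlet conjunct by the shared transfer BoundaryTransferWeak (stmt-0827). X
itself is to come as
StaticResponseBound (finite compressibility at every wavelength, the H₋₁ input) → SpaceTimeLiouville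
(the parabolic
large-scale-regularity / Liouville engine). The card's bath-mass dial η⁻¹Σ_(j≥1)Δ_j is filed at both
ends as calibration, off the
deciding chain: FrozenBathNoBEC (η = ∞: quenched scatterers, Lifshitz localisation, NO condensation
— provable now) and
LightBathCoherence (η → 0: complete coherence of the tagged boson).
Lean: `∀ v : ℝ → ENNReal,
Literature.MathematicalPhysics.QuantumManyBody.BoseGas.IsRepulsiveFiniteRange v → ∃ ρ₀ : ℝ, 0 < ρ₀ ∧
∀ ρ : ℝ, 0 < ρ → ρ < ρ₀ → ∃ c : ℝ, 0 < c ∧ ∀ᶠ N : ℕ in Filter.atTop, ∃ δ : ENNReal, 0 < δ ∧ ∀ Θ :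
Literature.MathematicalPhysics.QuantumManyBody.BoseGas.PeriodicTrialState N
(Literature.MathematicalPhysics.QuantumManyBody.BoseGas.sideLength ρ (N + 1)), ∀ Ψ :
Literature.MathematicalPhysics.QuantumManyBody.BoseGas.PeriodicTrialState (N + 1)
(Literature.MathematicalPhysics.QuantumManyBody.BoseGas.sideLength ρ (N + 1)),
Literature.MathematicalPhysics.QuantumManyBody.BoseGas.periodicEnergy v Θ ≤
Literature.MathematicalPhysics.QuantumManyBody.BoseGas.periodicGroundStateEnergy v N
(Literature.MathematicalPhysics.QuantumManyBody.BoseGas.sideLength ρ (N + 1)) + δ →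
Literature.MathematicalPhysics.QuantumManyBody.BoseGas.periodicEnergy v Ψ ≤
Literature.MathematicalPhysics.QuantumManyBody.BoseGas.periodicGroundStateEnergy v (N + 1)
(Literature.MathematicalPhysics.QuantumManyBody.BoseGas.sideLength ρ (N + 1)) + δ → ENNReal.ofReal c
≤ ENNReal.ofReal ((Literature.MathematicalPhysics.QuantumManyBody.BoseGas.sideLength ρ (N + 1) ^
3)⁻¹) * (‖∫ X in Literature.MathematicalPhysics.QuantumManyBody.BoseGas.cellN N
(Literature.MathematicalPhysics.QuantumManyBody.BoseGas.sideLength ρ (N + 1)), conj (Θ.ψ X) * ∫ x in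
Literature.MathematicalPhysics.QuantumManyBody.BoseGas.cell
(Literature.MathematicalPhysics.QuantumManyBody.BoseGas.sideLength ρ (N + 1)), Ψ.ψ (Matrix.vecCons x
X)‖₊ : ENNReal) ^ 2`

## Assembly
Pure logic, certified natively: `theorem closes (hK : StaticResponseBound) (hE : SpaceTimeLiouville)
(hG : ResponseLiouvilleGlue)
(hR : ResidueCondensesAll) (hT : BoundaryTransferWeak) : BoseEinsteinCondensation := fun v hv => hT
v hv (hR v hv (hG hK hE))`
(axioms propext / Classical.choice / Quot.sound). hG runs the engine at each admissible v and IS the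
target X (glue, stmt-14094); hR is
this route's own per-potential "residue ⇒ constant-mode torus BEC" (Cauchy–Schwarz against one
near-minimiser Θ; it replaces the shared
stmt-12059, whose hypothesis names the ∃Θ target of BECInsertionCorrector: refuter objection F2a);
hT returns HasGroundStateBEC v ρ for
ρ < ρ₀(v), the conjunct by name. The dial's ends LightBathCoherence / FrozenBathNoBEC are NOT
hypotheses of `closes`.

Rationale: WHY THIS LINE. Read n₀/N on the torus through the insertion amplitude h = Ψ_(N+1)/Ψ_N > 0, the
positive ground state of the LINEAR operator
−Δ_y − G_N + Σ_j v(y − x_j) over the ground-state (Doob) diffusion G_N of the N-boson bath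
(invariant law |Ψ_N|²): Z_N = (Eh)²/Eh² is
its flatness, so T = 0 BEC is a DElocalisation statement for one particle in a self-generated,
stationary, time-dependent random medium
— and the card's dial makes the two ends theorems of opposite sign: freeze the bath (η = ∞) and the
medium is a static Poisson-type
field whose Lifshitz tails pin h in the largest void, λ_max = o(N) at every density (Sznitman1998,
GerminetHislopKlein2007; condensation
INTO the localised state in the Kac–Luttinger reading, BoccatoKernerPechmann2024); lighten it (η →
0) and the tagged boson is completely
coherent, 1 − Z ≍ η^(3/2)ρ^(1/2)(∫v)^(3/2)/(4π) (one loop, this session). What tips η = 1, d = 3 to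
the extended side is recoil plus
finite compressibility: the variance of the block potential time-averaged over ℓ² is ≤ (2/ℓ²)·m₋₁
(Kipnis–Varadhan: m₋₁ = Σ|⟨n|ρ_k|0⟩|²/ω_n
IS the H₋₁ norm of the Doob dynamics, KipnisVaradhan1986), giving the dynamic Harris count g²(ℓ) ≍
(a²ρ/c²)ℓ^(2−d): irrelevant in d = 3
(already ≍ √(ρa³) at ℓ = ξ), marginal in d = 2, relevant in d = 1 — the same trichotomy as the
annealed survival among MOBILE traps,
e^(−λt), e^(−λt/log t), e^(−λ√t) (DrewitzEtAl2011 = arXiv:1010.3958 Thm 1.1, read pp. 2–5), whereas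
frozen traps give Lifshitz tails in
every d. Imported, with dictionary: quantitative stochastic homogenisation / large-scale regularity
for parabolic equations and its
configuration-space version for particle systems (ArmstrongBordasMourrat2018,
ArmstrongKuusiMourrat2019, GiuntiGuMourrat2022)
[environment ↦ |Ψ_N|²-stationary bath dynamics; corrector ↦ log h − const; scale-ℓ ellipticity
defect ↦ g(ℓ); coefficient-field mixing
↦ the static response bound StaticResponseBound]; random Schrödinger / Lifshitz-tail localisation
for the frozen end; Bose-polaron
mass dependence for the light end (GuentherEtAl2021, MysliwySeiringer2020, LampartTriay2025,
CucchiettiTimmermans2006). What it does that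
open routes do not: BECCutLineWeakDisorder attacks the same world-line with the two-replica L²
(Bolthausen) criterion on a landscape
hinge; BECNewtonPolicyIteration / BECMeanFieldControl / BECParentAnchor want one-atom landscape or
rigidity bounds; this line wants only
finite compressibility (a second-order ENERGY response, shared verbatim with the retired sibling
BECRecoilCorrector's K1 so the two
insertion routes pool provers on it) and puts the whole open weight into ONE quenched regularity
theorem, with a provable negative
endpoint that is a checkable no-go filter: any BEC argument whose estimates survive freezing the
bath proves nothing. Negatives index:
no BEC entry bears on it (only BECSwapAffinity.SwapJensen, a pointwise Jensen step this line never
uses).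

RANKED CRUXES. #0 InsertionResidue (target) — X as in § Thesis — no orthogonality catastrophe for
zero-momentum insertion on the torus: |⟨φ₀⊗Θ_N, Ψ_(N+1)⟩|² ≥ c between δ-near-minimisers of the
periodic N- and (N+1)-body energies on the torus of side ((N+1)/ρ)^(1/3), ρ < ρ₀(v), N large; for
ground states Z_N = (Eh)²/Eh², h = Ψ_(N+1)/Ψ_N (Bogoliubov: Z_N = 1 − O(√(ρa³))). Shared verbatim
with the retired sibling BECRecoilCorrector (stmt-4385; re-attached here). (why it might fail: Z_N→0
(insertion orthogonality catastrophe) does occur when the bath is ideal, even for a mobile particle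
(GuentherEtAl2021 eqs (3),(10)); Z_N ≥ c presupposes finite compressibility uniformly in
L=(N/ρ)^{1/3} — open, morally as hard as BEC.) [GuentherEtAl2021, PenroseOnsager1956, Reatto1969,
LiebSeiringerSolovejYngvason2005, LampartTriay2025]
#2 SpaceTimeLiouville (crux) — THE ENGINE (card L1), per potential: for every repulsive finite-range
v, the static-response body of StaticResponseBound for v implies the insertion-residue body of
InsertionResidue for v. Intended proof object: h = Ψ_(N+1)/Ψ_N > 0 solves (−G_N − Δ_y + Σ_j v^per(y
− x_j))h = (E_(N+1) − E_N)h over the |Ψ_N|²-stationary bath diffusion; a first-order Liouville /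
large-scale-regularity theorem "positive solutions are constant up to a corrector bounded in
L²(|Ψ_N|²dX⊗dy)", run from the healing length ξ = (8πρa)^(−1/2) upward with scale-ℓ ellipticity
defect g²(ℓ) = ℓ⁴·Var(block potential time-averaged over ℓ²) ≤ 2ℓ²·v̂(0)²·m₋₁(block density) ≍
C·a²ρ·ℓ⁻¹ (d = 3, by the hypothesis), summable in dyadic ℓ and already ≍ √(ρa³) at ℓ = ξ; below ξ
the bare (possibly hard-core) coupling is renormalised to the scattering length by two-body
(Dyson-lemma) technology. Exact a-priori input available to the prover: E|∇_y h|² ≤ μ_N·E h² (W ≥ 0,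
−G_N ≥ 0), i.e. all the tagged kinetic energy is O(ρa) per unit mass — flatness is the statement
that it sits at scales ≲ ξ. v ≡ 0 is included (free torus gas: Wirtinger). [difficulty:
open-problem] (why it might fail: K1 bounds only H₋₁ norms (2nd moments of time averages) of LINEAR
density functionals; quenched large-scale regularity needs rated decorrelation of ALL coarse-grained
functionals of a medium independent of the walker (finite range/α-mixing) — |Ψ_N|² is unknown,
gapless, reacts to the tagged boson.) [ArmstrongBordasMourrat2018, ArmstrongKuusiMourrat2019,
GiuntiGuMourrat2022, KipnisVaradhan1986, ArmstrongMourrat2015, DrewitzEtAl2011, CometsYoshida2006,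
GuentherEtAl2021]
#3 StaticResponseBound (crux) — STATIC RESPONSE BOUND (card L1's mixing input, energy currency;
verbatim the retired sibling BECRecoilCorrector's K1, stmt-4387, re-attached so both insertion
routes want one item): for every repulsive finite-range v there are ρ₀ > 0 and C such that for 0 < ρ
< ρ₀, EVERY N, every k ∈ ℤ³∖{0} (p = 2πk/L, L = (N/ρ)^(1/3)), every t ∈ ℝ and every periodic trial
state Ψ of finite energy: ⟨Ψ,(H_N + tΣ_j cos(p·x_j))Ψ⟩ ≥ E₀^per(N,L) − C t² N / max(ρa, |p|²), a =
scattering length — i.e. m₋₁(ρ_p)/N ≤ C/max(ρa,p²) (Bogoliubov ½/(p²+16πρa); compressibility sum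
rule at p → 0, Stringari1995 §2.2) uniformly in N and down to p = 2π/L; large |t| is the trivial
bound −|t|N, a = 0 (free gas) is Feshbach on the one-body Mathieu problem. By momentum conservation
of the torus ground state it yields the H₋₁ norm of every one-body bath observable Σ_j f(x_j), which
is what the engine's time-averaging consumes (Var of a time-T average ≤ (2/T)m₋₁). [difficulty:
open-problem] (why it might fail: Needs the CURVATURE of E₀(H+tΣcos) in t uniformly in k down to
2π/L and in N at fixed small ρ — finer than LHY-precision energies at k∼1/L (LDA + localized
Bogoliubov must control second differences); a long-wavelength density-wave softening m₋₁(k) ≫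
1/(ρa) would refute it.) [FournaisSolovej2020, Fournais2020, Stringari1995, PitaevskiiStringari1991,
BoccatoEtAl2019Acta, GuentherEtAl2021, KipnisVaradhan1986]
#4 BoundaryTransferWeak (crux) — shared verbatim with stmt-0827 (home BECPeriodicReduction, wanted
by 30+ routes): for each repulsive finite-range v, constant-mode BEC of δ-near-minimisers of the
periodic energy on the torus of side (N/ρ)^(1/3) for ρ < ρ₀ implies ∃ρ₀>0 ∀ρ∈(0,ρ₀)
HasGroundStateBEC v ρ (Dirichlet ground state, λ_max(γ) ≥ cN via condensateNumber). Not glue: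
near-minimiser slacks are O(N/L²) while Dirichlet/periodic energies differ by a wall term ≫ N/L²;
expected route: Neumann bracketing of interior sub-boxes + a mode-free criterion; fallback for THIS
line: rerun the engine in the Dirichlet box (large-scale regularity handles boundary layers) with
the mode-free removal bound of BECRecoilCorrector.DirichletRemovalBound. [difficulty: L] (why it
might fail: PeriodicBEC(v) is ground-state-only (δ after N): the Dirichlet ground state lies a wall
term ≫δ above E₀^per and interior restrictions are neither periodic nor of sharp N, so the
hypothesis may never fire (transfer≈conjunct); BEC is boundary-condition-sensitive for attractive
walls (Robinson 1976).) [LiebSeiringerSolovejYngvason2005, arXiv:2203.01841, arXiv:2205.15284,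
doi:10.1007/bf01608554, Junge2026]
#5 LightBathCoherence (crux) — the η → 0 end of the card's bath-mass dial (calibration, off the
deciding chain; verbatim gen-1 stmt-5532): for every repulsive finite-range v with ∫v(|x|)dx < ∞,
every ρ > 0 and ε > 0 there is η₀ > 0 such that for 0 < η < η₀ and all large N there is δ > 0 with:
every C¹, Lℤ³-periodic, cell-normalised ψ on (ℝ³)^(N+1) (particle 0 tagged, no permutation symmetry
imposed — the absolute ground state is bath-symmetric anyway) whose deformed energy E_η(ψ) = ∫_cell
|∇₀ψ|² + η⁻¹Σ_(j≥1)|∇_jψ|² + Σ_(i<j) v^per(x_i − x_j)|ψ|² is within δ of its infimum has tagged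
constant-mode weight ≥ 1 − ε (condensateOccupation (N+1) L ψ ≥ (1−ε)(N+1), L = ((N+1)/ρ)^(1/3); the
head of vecCons is particle 0; at η = 1 this weight IS n₀/N). Multiplying by η: a heavy probe weakly
(Born, a_ib ≍ η∫v/4π) coupled to a nearly ideal but stiff bath (c_b² ≍ ρ∫v/η); one loop: 1 − Z ≍
η^(3/2)ρ^(1/2)(∫v)^(3/2)/(4π) → 0. [difficulty: XL] (why it might fail: Z→1 as η→0 needs the PHONON
stiffness ω_b(k) ≳ c_b·k of the weakly coupled bath (m₋₂/Landau-type bound; a heavy probe has no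
recoil regularisation) uniformly in N — unproved in the TL at any coupling; in an ideal bath the
heavy probe has a bosonic orthogonality catastrophe (GuentherEtAl2021 eq. 3).) [GuentherEtAl2021,
MysliwySeiringer2020, LampartTriay2025, AstrakharchikPitaevskii2004, CucchiettiTimmermans2006,
Seiringer2011]
#9 ResidueCondenses (support) — InsertionResidue → PeriodicBEC (the constant-mode BEC body that
BoundaryTransferWeak consumes, for every v; verbatim stmt-4388): given an (N+1)-body
δ-near-minimiser Ψ pick an N-body δ-near-minimiser Θ on the same torus (iInf property; the constant
state shows PeriodicTrialState N L is inhabited; any Θ if E₀ = ⊤), unfold condensateOccupation (N+1)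
L Ψ = (N+1)L⁻³∫_(cell^N)|∫_cell Ψ(x,Y)dx|²dY, Cauchy–Schwarz against Θ gives ≥ (N+1)L⁻³|overlap|² ≥
c(N+1); shift ∀ᶠN ↦ N+1. Lean-heavy parts: Fubini/measurability for C¹ periodic integrands,
Cauchy–Schwarz between ∫⁻ and the Bochner integral. [difficulty: provable-now]
[LiebSeiringerSolovejYngvason2005, PenroseOnsager1956, Fournais2020]
#9 FrozenBathNoBEC (support) — the η = ∞ end of the dial, the card's negative theorem-candidate
Q-loc in its i.i.d. form (verbatim gen-1 stmt-5533): for every repulsive finite-range v with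
scattering length > 0, every ρ > 0 and ε > 0, for all large M (L = (M/ρ)^(1/3)) the set of scatterer
configurations Y ∈ cell^M for which the ONE-body quenched problem h_Y = −Δ + Σ_j v^per(x − Y_j) on
the torus has near-ground states (at every precision δ) with constant-mode weight > ε has measure ≤
ε|cell^M| (probability ≤ ε under i.i.d. uniform scatterers). Elementary proof: whp an empty ball of
radius R → ∞ gives e_Y ≲ R⁻²; Neumann bracketing into cubes of side ℓ: an occupied cube has local
ground energy ≥ c(ℓ,v) > 0, so near-ground states put mass ≤ (e_Y+δ)/c(ℓ) there; unoccupied volume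
fraction concentrates at e^(−ρℓ³/8); Cauchy–Schwarz: (∫φ)²/L³ ≤ 2·mass_occ + 2·frac_unocc → 0. Hard
cores included. This is the calibration theorem: a BEC mechanism insensitive to the bath's kinetic
term proves nothing, since the frozen bath never condenses a test particle, in any dimension, at any
density. [difficulty: provable-now] [Sznitman1998, GerminetHislopKlein2007,
BoccatoKernerPechmann2024, LiebSeiringerSolovejYngvason2005]

TWO-LAYER PLAN. Foreseen glued splits (nothing filed now; k ≤ 3, depth 1). SpaceTimeLiouville ⇐
HealingScaleDefect (from StaticResponseBound(v): the
ellipticity defect at the healing scale obeys g²(ξ) ≤ C√(ρa³) — local number moments plus two-body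
renormalisation of the bare v to the
scattering length below ξ, the only place hard cores are felt) → LargeScaleFlatness (from scale ξ
upward: an excess-decay / Campanato
iteration for positive solutions in the |Ψ_N|²-stationary space-time medium with summable defects
Σ_ℓ g(ℓ) < ∞ ⇒ corrector bounded in
L² ⇒ Z_N ≥ 1 − C′√(ρa³)) → SpaceTimeLiouville; if the iteration needs more than H₋₁ input, the
honest middle child is ResponseStability
(StaticResponseBound uniformly under weak, slowly varying periodic external fields — what a
renormalisation step actually propagates).
StaticResponseBound ⇐ LargeK (|p| ≳ ξ⁻¹: Neumann localisation into Fournais boxes where complete BEC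
and Bogoliubov with an external
cosine are theorems) → SmallK (|p| ≲ ξ⁻¹: LDA against e(ρ) with e″ ≥ 8πa(1 − o(1))) →
StaticResponseBound. LightBathCoherence ⇐
BathPhonons(η) (a Landau/m₋₂ lower bound for the ηv-bath) → HeavyProbeDressing → LightBathCoherence.
If BoundaryTransferWeak stalls: a
Dirichlet rerun (InsertionResidueDirichlet with the GP-profile mode, assembled through a mode-free
removal bound) as a sibling route.

KILL CRITERIA. ¬InsertionResidue for some admissible v at arbitrarily small ρ (an insertion
orthogonality catastrophe WITH interactions and recoil) closes
the route (`refuted:InsertionResidue`) and retires the insertion family of cards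
(kv-insertion-corrector, swap-overlap, one-particle-at-a-time),
not the conjunct. ¬StaticResponseBound (a density-wave softening m₋₁(p)·max(ρa,p²)/N unbounded along
L = (N/ρ)^(1/3)) closes the route and is
major negative knowledge for every corrector/landscape card; if it dies only through its ∀N/∀t
over-reach (small boxes, nonlinear t) it is
`misstated` and the repair is the ∀ᶠN, |t| ≤ t₀ρa version. StaticResponseBound ∧ ¬InsertionResidue
refutes SpaceTimeLiouville: close, the
homogenisation reading of BEC is wrong. ¬LightBathCoherence (tagged decoherence surviving η → 0)
kills the dial's positive end and the
perturbative anchor of the engine but not the deciding chain — record and continue. ¬FrozenBathNoBEC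
cannot happen for a > 0. ¬BoundaryTransferWeak
kills this and 30 sibling routes' last step, not the torus statements — pivot to the Dirichlet
rerun. PeriodicBEC or InsertionResidue proved
elsewhere moots ranks 2–3 (the endpoints stay as Literature-grade targets).

NOT DECOMPOSED YET. The function spaces of the engine (ground-state Dirichlet form Σ∫|∇_i f|²Ψ_N²,
the product generator −G_N − Δ_y and its H₋₁; existence /
positivity / uniqueness of finite-volume torus ground states by Perron–Frobenius — needed only
INSIDE the proof of SpaceTimeLiouville, every
item is stated over near-minimisers); the own-law frozen bath (scatterers drawn from |Ψ_N|² instead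
of i.i.d.: needs void statistics of the
quantum gas, rigidity-tolerance territory) and the self-trapped large-η phase of the true dial (η >
η_c ≍ ρ^(−1/2): bubble, f(η) = 0 —
deliberately not filed); monotonicity / continuity of f(η) = liminf λ_max/N in η (unknown, and it
cannot transport the light-bath anchor to
η = 1 in any case: f decreases towards the frozen end); the d = 2 marginal case and positive
temperature (Space = ℝ³, T = 0 hard-wired);
constants C ≍ 1 in StaticResponseBound, c ≍ e^(−C′√(ρa³)); the layer-2 children above.

CHEAPEST FALSIFIER. For the engine's relevance count: the one-loop tagged depletion computed from
StaticResponseBound + recoil must reproduce the Bose-polaron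
residue at equal masses, 1 − Z = (1/V)Σ_k |v̂(k)|²·N S(k)/(k² + ω_k)² ≤ (ρ/4)∫|v̂|² (m₋₁/N) k⁻²
d³k/(2π)³ = (√π/2)√(ρa³)·(1+o(1)) with
Bogoliubov m₋₁/N = ½/(k²+16πρa) (done this session: finite, right order against the gas depletion
(8/3√π)√(ρa³)); the frozen bath must come out
IR-divergent (∫d³k S(k)/k⁴ = ∞: it does) and a frozen HYPERUNIFORM bath log-marginal (S ∝ k: it
does); the mass-imbalanced check against
GuentherEtAl2021 eq. (14) vs (3) and the published Bogoliubov Bose-polaron residue with mass ratio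
is the refuter's first job — a mismatch in
the η-exponent 3/2 kills LightBathCoherence's rationale, a mismatch at η = 1 kills the Harris count.
For StaticResponseBound: the a = 0 corner
must read E(t) ≥ −Ct²N/p² (true, Mathieu/Feshbach, C = 2) and the ∀t clause must survive the LDA
crossover t ∼ 8πρa (it does with C ≍ 1:
−|t|N takes over at |t| ≥ max(ρa,p²)/C). For FrozenBathNoBEC nothing to falsify — a grounder
confirms the four-step proof in an hour.

NUMBERS. Bogoliubov (ħ = 2m = 1, μ = 8πρa): m₋₁(ρ_k)/N = ½/(k² + 16πρa) ≤ min(1/(2k²), 1/(32πρa));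
compressibility sum rule ∫ω⁻¹S = ½χ(q) → 1/mc²,
S(q) ≤ q/2mc (Stringari1995 §2.2 (10), p. 74); ideal gas χ(q) ∝ 1/q² (ibid.). Dynamic Harris count
g²(ℓ) ≍ (a²ρ/c²)ℓ^(2−d), g²(ξ) ≍ √(ρa³)
at ξ = (8πρa)^(−1/2) (d = 3). Tagged one-loop depletion (√π/2)√(ρa³) ≈ 0.89√(ρa³) vs gas depletion
(8/(3√π))√(ρa³) ≈ 1.50√(ρa³)
(LiebSeiringerSolovejYngvason2005 Ch. 5). Light bath: a_b ≍ η∫v/16π, c_b² ≍ ρ∫v/η, 1 − Z ≍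
η^(3/2)ρ^(1/2)(∫v)^(3/2)/(4π). Mobile-trap survival
(DrewitzEtAl2011 Thm 1.1/1.2): annealed e^(−λ₁√t) (d=1), e^(−λ₂t/log t) (d=2), e^(−λ_d t) (d≥3);
quenched exponential in all d. Orthogonality
benchmarks (GuentherEtAl2021): static impurity in an IDEAL BEC Z₀ ≈ exp(−αN^(1/3)(k_n a)²) (eq. 3);
mobile impurity in the interacting BEC Z > 0
(eq. 10). Self-trapping threshold of the dial η_c ≍ (a_b/a_ib^(5/2))ρ^(−1/2)
(CucchiettiTimmermans2006). Frozen i.i.d. bath: unoccupied-cube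
fraction e^(−ρℓ³), e_Y ≲ (ρ/log L)^(2/3). Gap-method ceiling L/a ≲ (ρa³)^(−3/4−η/2) (Junge2026 Cor.
6). Items at open: 8 (1 target, 4 cruxes,
2 support, 1 assembly).

DEFINITION REQUESTS. None for the filed items (PeriodicTrialState, periodicEnergy,
periodicGroundStateEnergy, periodizedPotential, periodicInteraction,
condensateOccupation, kineticDensity, cell, cellN, sideLength, scatteringLength, HasGroundStateBEC
all exist in
Literature.MathematicalPhysics.QuantumManyBody.BoseGas). Foreseen when SpaceTimeLiouville is split:
a GroundStateDirichletForm / H₋₁ vocabulary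
over |Ψ|²dX (topic Summits/AtomisticToContinuum/BoseEinsteinCondensation/Theorems) so that
HealingScaleDefect can be an item rather than prose —
requested then, not now.

Novelty: Searches (2026-08-15, this seat): `lit search --hybrid --no-graph` ×3 ("principal eigenfunction
localization dynamic random environment mobile
obstacles", "quantitative stochastic homogenization parabolic space-time … Liouville", "Bose
Einstein condensation random potential Lifshitz tail
Kac Luttinger Poisson obstacles": vector leg only, FTS leg down; nothing relevant held beyond
Chulaevsky–Suhov 2014 multi-particle localisation);
`lit galaxy search --star all` ×5 ("Kac-Luttinger" 1 irrelevant; "mobile traps" → pdf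
arXiv:0805.2920 Yuste–Oshanin–Lindenberg–Bénichou–Klafter,
survival among mobile traps; "Bose polaron" → textbooks only; "dynamic random environment" →
Comets's directed-polymer monograph and arXiv:1503.08280,
anchored Nash inequalities for dynamic degenerate environments; the long phrase 0 rows); `lit search
--source crossref` ×2 ("Bose polaron mass ratio
residue heavy impurity" → doi:10.1103/physrevlett.131.186001 Petković–Ristivojevic 2023,
doi:10.1103/physreva.104.052218, doi:10.1103/physreva.88.053610
— impurity physics, no bath-mass deformation; "stochastic homogenization tagged particle interacting
Bose gas ground state" → 0 relevant);
`lit frontier AtomisticToContinuum --since 2021` (30 rows: arXiv:2510.20493 kinetic localisation via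
Poincaré-type inequalities, arXiv:2603.20776
Neumann localisation — gap class; no homogenisation link); `lit bridges AtomisticToContinuum --cross
any` (no Bose/homogenisation bridge);
`lit read arxiv:1010.3958` pp. 2–5 (DGRS tr  [refs: 10.1103/physrevlett.131.186001, 10.1103/physreva.104.052218, 10.1103/physreva.88.053610, 10.1016/j.matpur.2024.06.009, 10.1103/physreva.103.013317, 0805.2920, 1503.08280, 2510.20493, 2603.20776, 1010.3958, doi:10.1103/physrevlett.131.186001, doi:10.1103/physreva.104.052218, doi:10.1103/physreva.88.053610, arxiv:1010.3958, doi:10.1016/j.matpur.2024.06.009, doi:10.1103/physreva.103.013317, Sznitman1]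

Barriers (technique_class: bath-mass-deformation, homogenisation, density-response): - technique_class: bath-mass-deformation, homogenisation, density-response
- Literature.Barriers.AtomisticToContinuum.KineticGapLengthScales: evaded in form — no item uses the
box gap (2π/L)²; the only a-priori Poincaré step (E|∇_y h|² ≤ μ_N ⇒ flat up to L ∼ ξ) is exactly the
GP-scale statement the barrier allows, and the engine's content is what happens ABOVE ξ, where its
small parameter g²(ℓ) ∝ ℓ⁻¹ decreases with the scale; conceded that a proof of StaticResponseBound
by energy localisation in sub-boxes re-imports gap bookkeeping at large |p| only (Fournais boxes),
never at the thermodynamic scale.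
- Literature.Barriers.AtomisticToContinuum.KineticGapLengthScalesNarrow: its class is energy-WINDOW
arguments; every item here has δ chosen after N (ground-state-only), outside the Galilei-boost
witness.
- Literature.Barriers.AtomisticToContinuum.BogoliubovPerturbationInfrared: the d = 3 logarithms live
in the bath's anomalous propagators; the route consumes only m₋₁ (an inverse moment the
compressibility sum rule keeps finite) and a tagged-particle corrector that is power-counting
irrelevant (g² ∝ ℓ⁻¹, vertices are density couplings with recoil resolvents (ω + k²)⁻¹); no
expansion around the Bogoliubov state is summed — conceded that PROVING StaticResponseBound may need
infrared control of the bath of comparable depth.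
- Literature.Barriers.AtomisticToContinuum.BogoliubovPerturbationInfraredNarrow: places the line on
its not-covered side (density response / derivative vertices,

History (route lifecycle, newest last):
- 2026-08-16T03:21:22Z · rev 4: restated Assembly (stmt-AtomisticToContinuum-13804) — badge repair (unit rbadge-AtomisticToContinuum-BECBathMas-88e6fec2, one-shot; needs_repair route.target-unreachable was already cleared at rev 3 by rchoice-16bd (planner-rbadge-AtomisticToContinuum-BECBathMas-88e6fec2-0)
- 2026-08-16T03:21:22Z · rev 4: dropped stmt-AtomisticToContinuum-12059 — badge repair (unit rbadge-AtomisticToContinuum-BECBathMas-88e6fec2, one-shot; needs_repair route.target-unreachable was already cleared at rev 3 by rchoice-16bd (planner-rbadge-AtomisticToContinuum-BECBathMas-88e6fec2-0)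
- 2026-08-24T23:41:29Z · DORMANT — reconciler: no traction for 7.2 d (last activity item-evidence-added at 2026-08-17T18:55:01Z); parked, not closed — `ledger route dormant route-AtomisticToConti (operator:999:977265)

sub-problem: BoseEinsteinCondensation · status: dormant · opened planner-plancard-AtomisticToContinuum-BoseEin-61acd54c-g2-0 2026-08-15T19:03:26Z · rev 5 · ledger route-AtomisticToContinuum-BECBathMassLiouville
GENERATED by the gate from the ledger (D-0016/17). Provers cite these decls: `theorem foo : Summit.AtomisticToContinuum.BoseEinsteinCondensation.Theses.BECBathMassLiouville.<Decl> := …` in Summits/AtomisticToContinuum/BoseEinsteinCondensation/Theorems/<Name>.lean.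
-/

namespace Summit.AtomisticToContinuum.BoseEinsteinCondensation.Theses.BECBathMassLiouville

open scoped BigOperators Topology Manifold Classical MeasureTheory ProbabilityTheory Matrix InnerProductSpace ComplexConjugate ContinuousMap
open Filter Set Function TopologicalSpace MeasureTheory

attribute [summit_statement] _root_.BoseEinsteinCondensation

/-- item stmt-AtomisticToContinuum-13800 · target · rank 0 · open · by planner
why it might fail: Z_N→0 (insertion orthogonality catastrophe) does occur when the bath is ideal, even for a mobile particle (GuentherEtAl2021 eqs (3),(14)); Z_N ≥ c presupposes finite compressibility uniformly in L=(N/ρ)^{1/3} — open, morally as hard as BEC itself.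
sources: GuentherEtAl2021, PenroseOnsager1956, Reatto1969, LiebSeiringerSolovejYngvason2005, LampartTriay2025, Lieb1963
[target] X as in § Thesis — no orthogonality catastrophe for zero-momentum insertion on the torus:
|⟨φ₀⊗Θ_N, Ψ_(N+1)⟩|² ≥ c between δ-near-minimisers of the periodic N- and (N+1)-body energies on the
torus of side ((N+1)/ρ)^(1/3), ρ < ρ₀(v), N large; for ground states Z_N = (Eh)²/Eh², h =
Ψ_(N+1)/Ψ_N (Bogoliubov: Z_N = 1 − O(√(ρa³))). Shared verbatim with the retired sibling
BECRecoilCorrector (stmt-4385; re-attached here). -/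
@[route_item "route-AtomisticToContinuum-BECBathMassLiouville"]
def InsertionResidue : Prop :=
  ∀ v : ℝ → ENNReal, Literature.MathematicalPhysics.QuantumManyBody.BoseGas.IsRepulsiveFiniteRange v → ∃ ρ₀ : ℝ, 0 < ρ₀ ∧ ∀ ρ : ℝ, 0 < ρ → ρ < ρ₀ → ∃ c : ℝ, 0 < c ∧ ∀ᶠ N : ℕ in Filter.atTop, ∃ δ : ENNReal, 0 < δ ∧ ∀ Θ : Literature.MathematicalPhysics.QuantumManyBody.BoseGas.PeriodicTrialState N (Literature.MathematicalPhysics.QuantumManyBody.BoseGas.sideLength ρ (N + 1)), ∀ Ψ : Literature.MathematicalPhysics.QuantumManyBody.BoseGas.PeriodicTrialState (N + 1) (Literature.MathematicalPhysics.QuantumManyBody.BoseGas.sideLength ρ (N + 1)), Literature.MathematicalPhysics.QuantumManyBody.BoseGas.periodicEnergy v Θ ≤ Literature.MathematicalPhysics.QuantumManyBody.BoseGas.periodicGroundStateEnergy v N (Literature.MathematicalPhysics.QuantumManyBody.BoseGas.sideLength ρ (N + 1)) + δ → Literature.MathematicalPhysics.QuantumManyBody.BoseGas.periodicEnergy v Ψ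 ≤ Literature.MathematicalPhysics.QuantumManyBody.BoseGas.periodicGroundStateEnergy v (N + 1) (Literature.MathematicalPhysics.QuantumManyBody.BoseGas.sideLength ρ (N + 1)) + δ → ENNReal.ofReal c ≤ ENNReal.ofReal ((Literature.MathematicalPhysics.QuantumManyBody.BoseGas.sideLength ρ (N + 1) ^ 3)⁻¹) * (‖∫ X in Literature.MathematicalPhysics.QuantumManyBody.BoseGas.cellN N (Literature.MathematicalPhysics.QuantumManyBody.BoseGas.sideLength ρ (N + 1)), conj (Θ.ψ X) * ∫ x in Literature.MathematicalPhysics.QuantumManyBody.BoseGas.cell (Literature.MathematicalPhysics.QuantumManyBody.BoseGas.sideLength ρ (N + 1)), Ψ.ψ (Matrix.vecCons x X)‖₊ : ENNReal) ^ 2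

/-- item stmt-AtomisticToContinuum-13801 · crux · rank 2 · open · by planner
why it might fail: Hypothesis gives only H₋₁ norms (2nd moments of time averages) of LINEAR density modes; quenched Liouville/large-scale regularity needs rated decorrelation of ALL coarse-grained functionals of a walker-independent finite-range medium (AKM2019, GGM2022); |Ψ_N|² is gapless and reacts to the walker.
sources: ArmstrongBordasMourrat2018, ArmstrongKuusiMourrat2019, GiuntiGuMourrat2022, KipnisVaradhan1986, ArmstrongMourrat2015, DrewitzEtAl2011
[crux] THE ENGINE (card L1), per potential: for every repulsive finite-range v, the static-response
body of StaticResponseBound for v implies the insertion-residue body of InsertionResidue for v.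
Intended proof object: h = Ψ_(N+1)/Ψ_N > 0 solves (−G_N − Δ_y + Σ_j v^per(y − x_j))h = (E_(N+1) −
E_N)h over the |Ψ_N|²-stationary bath diffusion; a first-order Liouville / large-scale-regularity
theorem "positive solutions are constant up to a corrector bounded in L²(|Ψ_N|²dX⊗dy)", run from the
healing length ξ = (8πρa)^(−1/2) upward with scale-ℓ ellipticity defect g²(ℓ) = ℓ⁴·Var(block
potential time-averaged over ℓ²) ≤ 2ℓ²·v̂(0)²·m₋₁(block density) ≍ C·a²ρ·ℓ⁻¹ (d = 3, by the
hypothesis), summable in dyadic ℓ and already ≍ √(ρa³) at ℓ = ξ; below ξ the bare (possibly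
hard-core) coupling is renormalised to the scattering length by two-body (Dyson-lemma) technology.
Exact a-priori input available to the prover: E|∇_y h|² ≤ μ_N·E h² (W ≥ 0, −G_N ≥ 0), i.e. all the
tagged kinetic energy is O(ρa) per unit mass — flatness is the statement that it sits at scales ≲ ξ.
v ≡ 0 is included (free torus gas: Wirtinger). [difficulty: open-problem] -/
@[route_item "route-AtomisticToContinuum-BECBathMassLiouville", crux]
def SpaceTimeLiouville : Prop :=
  ∀ v : ℝ → ENNReal, Literature.MathematicalPhysics.QuantumManyBody.BoseGas.IsRepulsiveFiniteRange v → (∃ ρ₀ : ℝ, 0 < ρ₀ ∧ ∃ C : ℝ, 0 < C ∧ ∀ ρ : ℝ, 0 < ρ → ρ < ρ₀ → ∀ N : ℕ, ∀ k : Fin 3 → ℤ, k ≠ 0 → ∀ t : ℝ, ∀ Ψ : Literature.MathematicalPhysics.QuantumManyBody.BoseGas.PeriodicTrialState N (Literature.MathematicalPhysics.QuantumManyBody.BoseGas.sideLength ρ N), Literature.MathematicalPhysics.QuantumManyBody.BoseGas.periodicEnergy v Ψ ≠ ⊤ → (Literature.MathematicalPhysics.QuantumManyBody.BoseGas.periodicGroundStateEnergy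 v N (Literature.MathematicalPhysics.QuantumManyBody.BoseGas.sideLength ρ N)).toReal - C * t ^ 2 * N / max (ρ * (Literature.MathematicalPhysics.QuantumManyBody.BoseGas.scatteringLength v).toReal) ((2 * Real.pi / Literature.MathematicalPhysics.QuantumManyBody.BoseGas.sideLength ρ N) ^ 2 * ∑ i, (k i : ℝ) ^ 2) ≤ (Literature.MathematicalPhysics.QuantumManyBody.BoseGas.periodicEnergy v Ψ).toReal + t * ∫ X in Literature.MathematicalPhysics.QuantumManyBody.BoseGas.cellN N (Literature.MathematicalPhysics.QuantumManyBody.BoseGas.sideLength ρ N), (∑ j, Real.cos (2 * Real.pi / Literature.MathematicalPhysics.QuantumManyBody.BoseGas.sideLength ρ N * ∑ i, (k i : ℝ) * X j i)) * ‖Ψ.ψ X‖ ^ 2) → ∃ ρ₀ : ℝ, 0 < ρ₀ ∧ ∀ ρ : ℝ, 0 < ρ → ρ < ρ₀ → ∃ c : ℝ, 0 < c ∧ ∀ᶠ N : ℕ in Filter.atTop, ∃ δ : ENNReal, 0 < δ ∧ ∀ Θ : Literature.MathematicalPhysics.QuantumManyBody.BoseGas.PeriodicTrialState N (Literature.MathematicalPhysics.QuantumManyBody.BoseGas.sideLength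 ρ (N + 1)), ∀ Ψ : Literature.MathematicalPhysics.QuantumManyBody.BoseGas.PeriodicTrialState (N + 1) (Literature.MathematicalPhysics.QuantumManyBody.BoseGas.sideLength ρ (N + 1)), Literature.MathematicalPhysics.QuantumManyBody.BoseGas.periodicEnergy v Θ ≤ Literature.MathematicalPhysics.QuantumManyBody.BoseGas.periodicGroundStateEnergy v N (Literature.MathematicalPhysics.QuantumManyBody.BoseGas.sideLength ρ (N + 1)) + δ → Literature.MathematicalPhysics.QuantumManyBody.BoseGas.periodicEnergy v Ψ ≤ Literature.MathematicalPhysics.QuantumManyBody.BoseGas.periodicGroundStateEnergy v (N + 1) (Literature.MathematicalPhysics.QuantumManyBody.BoseGas.sideLength ρ (N + 1)) + δ → ENNReal.ofReal c ≤ ENNReal.ofReal ((Literature.MathematicalPhysics.QuantumManyBody.BoseGas.sideLength ρ (N + 1) ^ 3)⁻¹) * (‖∫ X in Literature.MathematicalPhysics.QuantumManyBody.BoseGas.cellN N (Literature.MathematicalPhysics.QuantumManyBody.BoseGas.sideLength ρ (N + 1)), conj (Θ.ψ X) * ∫ x in Literature.MathematicalPhysics.QuantumManyBody.BoseGas.cell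 (Literature.MathematicalPhysics.QuantumManyBody.BoseGas.sideLength ρ (N + 1)), Ψ.ψ (Matrix.vecCons x X)‖₊ : ENNReal) ^ 2

/-- item stmt-AtomisticToContinuum-12057 · crux · rank 3 · open · by planner
why it might fail: Needs the t-curvature of E₀(H+tΣcos) with ONE C for all N, all t (non-perturbative window gap/N ≪ |t| ≲ ρa) and k down to 2π/L — finer than LHY-order energies at k∼1/L (FournaisSolovej2020); a long-wavelength softening m₋₁(k)·max(ρa,k²)/N → ∞ along L=(N/ρ)^{1/3} refutes it outright.
sources: FournaisSolovej2020, Fournais2020, Stringari1995, PitaevskiiStringari1991, BoccatoEtAl2019Acta, GuentherEtAl2021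
[crux] STATIC RESPONSE BOUND (card K1, energy currency; shared input of cards one-particle-at-a-time
/ swap-overlap-no-catastrophe): for every repulsive finite-range v there are ρ₀ > 0 and C such that
for 0 < ρ < ρ₀, EVERY N, every k ∈ ℤ³∖0 (p = 2πk/L, L = (N/ρ)^(1/3)), every coupling t ∈ ℝ and every
periodic trial state Ψ of finite energy: ⟨Ψ,(H_N + tΣ_j cos(p·x_j))Ψ⟩ ≥ E₀^per(N,L) − C t² N /
max(ρa, |p|²), a = scattering length — i.e. the second-order energy response N m₋₁(p)-type
coefficient is ≤ C N/max(ρa,p²) (Bogoliubov: 1/(p²+16πρa)) uniformly down to p = 2π/L and in N;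
large |t| is covered by the trivial bound −|t|N, small N by the free bound C/p² (Mathieu / Temple),
if a.toReal = 0 the bound merely weakens to the free form C/p². Ranked 2 as the most informative
item per unit effort: decidable with existing energy technology, shared by three cards, and its
failure kills the line outright. [difficulty: L] -/
@[route_item "route-AtomisticToContinuum-BECBathMassLiouville", crux]
def StaticResponseBound : Prop :=
  ∀ v : ℝ → ENNReal, Literature.MathematicalPhysics.QuantumManyBody.BoseGas.IsRepulsiveFiniteRange v → ∃ ρ₀ : ℝ, 0 < ρ₀ ∧ ∃ C : ℝ, 0 < C ∧ ∀ ρ : ℝ, 0 < ρ → ρ < ρ₀ → ∀ N : ℕ, ∀ k : Fin 3 → ℤ, k ≠ 0 → ∀ t : ℝ, ∀ Ψ : Literature.MathematicalPhysics.QuantumManyBody.BoseGas.PeriodicTrialState N (Literature.MathematicalPhysics.QuantumManyBody.BoseGas.sideLength ρ N), Literature.MathematicalPhysics.QuantumManyBody.BoseGas.periodicEnergy v Ψ ≠ ⊤ → (Literature.MathematicalPhysics.QuantumManyBody.BoseGas.periodicGroundStateEnergy v N (Literature.MathematicalPhysics.QuantumManyBody.BoseGas.sideLength ρ N)).toReal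 - C * t ^ 2 * N / max (ρ * (Literature.MathematicalPhysics.QuantumManyBody.BoseGas.scatteringLength v).toReal) ((2 * Real.pi / Literature.MathematicalPhysics.QuantumManyBody.BoseGas.sideLength ρ N) ^ 2 * ∑ i, (k i : ℝ) ^ 2) ≤ (Literature.MathematicalPhysics.QuantumManyBody.BoseGas.periodicEnergy v Ψ).toReal + t * ∫ X in Literature.MathematicalPhysics.QuantumManyBody.BoseGas.cellN N (Literature.MathematicalPhysics.QuantumManyBody.BoseGas.sideLength ρ N), (∑ j, Real.cos (2 * Real.pi / Literature.MathematicalPhysics.QuantumManyBody.BoseGas.sideLength ρ N * ∑ i, (k i : ℝ) * X j i)) * ‖Ψ.ψ X‖ ^ 2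

/-- item stmt-AtomisticToContinuum-0827 · crux · rank 4 · open · by planner
why it might fail: PeriodicBEC(v) is ground-state-only (δ after N): the Dirichlet ground state lies a wall term ≫δ above E₀^per and interior restrictions are neither periodic nor of sharp N, so the hypothesis may never fire (transfer≈conjunct); BEC is boundary-condition-sensitive for attractive walls (Robinson 1976).
sources: LiebSeiringerSolovejYngvason2005, arXiv:2203.01841, arXiv:2205.15284, doi:10.1007/bf01608554, Junge2026
[crux] BoundaryTransferWeak (mode-free boundary-condition transfer, per potential): for each
repulsive finite-range v, PeriodicBEC(v) implies ∃ρ₀>0 ∀ρ∈(0,ρ₀) HasGroundStateBEC v ρ (Dirichlet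
ground state, λ_max(γ) ≥ cN via condensateNumber). Not glue: near-minimiser slacks are O(N/L²) while
Dirichlet/periodic energies differ by a boundary term ≫ N/L², so no energy-comparison proof;
expected route: Neumann bracketing of interior sub-boxes (−Δ_Dir ≥ ⊕−Δ_Neu, v ≥ 0) + a mode-free
criterion (λ_max ≥ tr γ²/N). Only the ENERGY analogue is in print (LiebSeiringerSolovejYngvason2005
Ch. 2 after (2.8)). v ≡ 0: hypothesis and conclusion both true. -/
@[route_item "route-AtomisticToContinuum-BECBathMassLiouville", crux]
def BoundaryTransferWeak : Prop :=
  ∀ v : ℝ → ENNReal, Literature.MathematicalPhysics.QuantumManyBody.BoseGas.IsRepulsiveFiniteRange v → (∃ ρ₀ : ℝ, 0 < ρ₀ ∧ ∀ ρ : ℝ, 0 < ρ → ρ < ρ₀ → ∃ c : ℝ, 0 < c ∧ ∀ᶠ N : ℕ in Filter.atTop, ∃ δ : ENNReal, 0 < δ ∧ ∀ Ψ : Literature.MathematicalPhysics.QuantumManyBody.BoseGas.PeriodicTrialState N (Literature.MathematicalPhysics.QuantumManyBody.BoseGas.sideLength ρ N), Literature.MathematicalPhysics.QuantumManyBody.BoseGas.periodicEnergy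 v Ψ ≤ Literature.MathematicalPhysics.QuantumManyBody.BoseGas.periodicGroundStateEnergy v N (Literature.MathematicalPhysics.QuantumManyBody.BoseGas.sideLength ρ N) + δ → ENNReal.ofReal (c * N) ≤ Literature.MathematicalPhysics.QuantumManyBody.BoseGas.condensateOccupation N (Literature.MathematicalPhysics.QuantumManyBody.BoseGas.sideLength ρ N) Ψ.ψ) → ∃ ρ₀ : ℝ, 0 < ρ₀ ∧ ∀ ρ : ℝ, 0 < ρ → ρ < ρ₀ → Literature.MathematicalPhysics.QuantumManyBody.BoseGas.HasGroundStateBEC v ρ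

/-- item stmt-AtomisticToContinuum-13802 · support · rank 5 · open · by planner
why it might fail: Z→1 as η→0 needs the PHONON stiffness ω_b(k) ≳ c_b·k of the weakly coupled (a_b ∝ η) bath uniformly in N, unproved in the TL at any coupling; without it a heavy probe has the bosonic orthogonality catastrophe of an ideal bath (GuentherEtAl2021 eq. (3); eq. (14): log Z ∝ −n₀ξ_b·a_ib², ξ_b ∝ a_b^-½).
sources: GuentherEtAl2021, arXiv:2004.07166, MysliwySeiringer2020, LampartTriay2025, AstrakharchikPitaevskii2004, CucchiettiTimmermans2006
[crux] the η → 0 end of the card's bath-mass dial (calibration, off the deciding chain; verbatim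
gen-1 stmt-5532): for every repulsive finite-range v with ∫v(|x|)dx < ∞, every ρ > 0 and ε > 0 there
is η₀ > 0 such that for 0 < η < η₀ and all large N there is δ > 0 with: every C¹, Lℤ³-periodic,
cell-normalised ψ on (ℝ³)^(N+1) (particle 0 tagged, no permutation symmetry imposed — the absolute
ground state is bath-symmetric anyway) whose deformed energy E_η(ψ) = ∫_cell |∇₀ψ|² +
η⁻¹Σ_(j≥1)|∇_jψ|² + Σ_(i<j) v^per(x_i − x_j)|ψ|² is within δ of its infimum has tagged constant-mode
weight ≥ 1 − ε (condensateOccupation (N+1) L ψ ≥ (1−ε)(N+1), L = ((N+1)/ρ)^(1/3); the head of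
vecCons is particle 0; at η = 1 this weight IS n₀/N). Multiplying by η: a heavy probe weakly (Born,
a_ib ≍ η∫v/4π) coupled to a nearly ideal but stiff bath (c_b² ≍ ρ∫v/η); one loop: 1 − Z ≍
η^(3/2)ρ^(1/2)(∫v)^(3/2)/(4π) → 0. [difficulty: XL] -/
@[route_item "route-AtomisticToContinuum-BECBathMassLiouville"]
def LightBathCoherence : Prop :=
  ∀ v : ℝ → ENNReal, Literature.MathematicalPhysics.QuantumManyBody.BoseGas.IsRepulsiveFiniteRange v → (∫⁻ x : Literature.MathematicalPhysics.QuantumManyBody.BoseGas.Space, v ‖x‖) ≠ ⊤ → ∀ ρ : ℝ, 0 < ρ → ∀ ε : ℝ, 0 < ε → ∃ η₀ : ℝ, 0 < η₀ ∧ ∀ η : ℝ, 0 < η → η < η₀ → ∀ᶠ N : ℕ in Filter.atTop, ∃ δ : ENNReal, 0 < δ ∧ ∀ ψ : Literature.MathematicalPhysics.QuantumManyBody.BoseGas.Config (N + 1) → ℂ, ContDiff ℝ 1 ψ → (∀ (X : Literature.MathematicalPhysics.QuantumManyBody.BoseGas.Config (N + 1)) (i : Fin (N + 1)) (k : Fin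 3), ψ (X + Pi.single i (EuclideanSpace.single k (Literature.MathematicalPhysics.QuantumManyBody.BoseGas.sideLength ρ (N + 1)))) = ψ X) → (∫⁻ X in Literature.MathematicalPhysics.QuantumManyBody.BoseGas.cellN (N + 1) (Literature.MathematicalPhysics.QuantumManyBody.BoseGas.sideLength ρ (N + 1)), (‖ψ X‖₊ : ENNReal) ^ 2) = 1 → (∫⁻ X in Literature.MathematicalPhysics.QuantumManyBody.BoseGas.cellN (N + 1) (Literature.MathematicalPhysics.QuantumManyBody.BoseGas.sideLength ρ (N + 1)), (∑ k : Fin 3, (‖fderiv ℝ ψ X (Pi.single (0 : Fin (N + 1)) (EuclideanSpace.single k (1 : ℝ)))‖₊ : ENNReal) ^ 2) + ENNReal.ofReal η⁻¹ * (∑ j : Fin N, ∑ k : Fin 3, (‖fderiv ℝ ψ X (Pi.single j.succ (EuclideanSpace.single k (1 : ℝ)))‖₊ : ENNReal) ^ 2) + Literature.MathematicalPhysics.QuantumManyBody.BoseGas.periodicInteraction v (Literature.MathematicalPhysics.QuantumManyBody.BoseGas.sideLength ρ (N + 1)) X * (‖ψ X‖₊ : ENNReal) ^ 2) ≤ (⨅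 (φ : Literature.MathematicalPhysics.QuantumManyBody.BoseGas.Config (N + 1) → ℂ) (_ : ContDiff ℝ 1 φ ∧ (∀ (X : Literature.MathematicalPhysics.QuantumManyBody.BoseGas.Config (N + 1)) (i : Fin (N + 1)) (k : Fin 3), φ (X + Pi.single i (EuclideanSpace.single k (Literature.MathematicalPhysics.QuantumManyBody.BoseGas.sideLength ρ (N + 1)))) = φ X) ∧ (∫⁻ X in Literature.MathematicalPhysics.QuantumManyBody.BoseGas.cellN (N + 1) (Literature.MathematicalPhysics.QuantumManyBody.BoseGas.sideLength ρ (N + 1)), (‖φ X‖₊ : ENNReal) ^ 2) = 1), ∫⁻ X in Literature.MathematicalPhysics.QuantumManyBody.BoseGas.cellN (N + 1) (Literature.MathematicalPhysics.QuantumManyBody.BoseGas.sideLength ρ (N + 1)), (∑ k : Fin 3, (‖fderiv ℝ φ X (Pi.single (0 : Fin (N + 1)) (EuclideanSpace.single k (1 : ℝ)))‖₊ : ENNReal) ^ 2) + ENNReal.ofReal η⁻¹ * (∑ j : Fin N, ∑ k : Fin 3, (‖fderiv ℝ φ X (Pi.single j.succ (EuclideanSpace.single k (1 : ℝ)))‖₊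 : ENNReal) ^ 2) + Literature.MathematicalPhysics.QuantumManyBody.BoseGas.periodicInteraction v (Literature.MathematicalPhysics.QuantumManyBody.BoseGas.sideLength ρ (N + 1)) X * (‖φ X‖₊ : ENNReal) ^ 2) + δ → ENNReal.ofReal ((1 - ε) * (N + 1)) ≤ Literature.MathematicalPhysics.QuantumManyBody.BoseGas.condensateOccupation (N + 1) (Literature.MathematicalPhysics.QuantumManyBody.BoseGas.sideLength ρ (N + 1)) ψ

/-- item stmt-AtomisticToContinuum-13803 · support · rank 9 · closed · proved by Summit.AtomisticToContinuum.BoseEinsteinCondensation.Theorems.frozenBathNoBEC_proof (prover) · by planner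
sources: Sznitman1998, GerminetHislopKlein2007, BoccatoKernerPechmann2024, LiebSeiringerSolovejYngvason2005
[support] the η = ∞ end of the dial, the card's negative theorem-candidate Q-loc in its i.i.d. form
(verbatim gen-1 stmt-5533): for every repulsive finite-range v with scattering length > 0, every ρ >
0 and ε > 0, for all large M (L = (M/ρ)^(1/3)) the set of scatterer configurations Y ∈ cell^M for
which the ONE-body quenched problem h_Y = −Δ + Σ_j v^per(x − Y_j) on the torus has near-ground
states (at every precision δ) with constant-mode weight > ε has measure ≤ ε|cell^M| (probability ≤ ε
under i.i.d. uniform scatterers). Elementary proof: whp an empty ball of radius R → ∞ gives e_Y ≲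
R⁻²; Neumann bracketing into cubes of side ℓ: an occupied cube has local ground energy ≥ c(ℓ,v) > 0,
so near-ground states put mass ≤ (e_Y+δ)/c(ℓ) there; unoccupied volume fraction concentrates at
e^(−ρℓ³/8); Cauchy–Schwarz: (∫φ)²/L³ ≤ 2·mass_occ + 2·frac_unocc → 0. Hard cores included. This is
the calibration theorem: a BEC mechanism insensitive to the bath's kinetic term proves nothing,
since the frozen bath never condenses a test particle, in any dimension, at any density.
[difficulty: provable-now] -/
@[route_item "route-AtomisticToContinuum-BECBathMassLiouville"]
def FrozenBathNoBEC : Prop :=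
  ∀ v : ℝ → ENNReal, Literature.MathematicalPhysics.QuantumManyBody.BoseGas.IsRepulsiveFiniteRange v → 0 < Literature.MathematicalPhysics.QuantumManyBody.BoseGas.scatteringLength v → ∀ ρ : ℝ, 0 < ρ → ∀ ε : ℝ, 0 < ε → ∀ᶠ M : ℕ in Filter.atTop, MeasureTheory.volume {Y : Literature.MathematicalPhysics.QuantumManyBody.BoseGas.Config M | Y ∈ Literature.MathematicalPhysics.QuantumManyBody.BoseGas.cellN M (Literature.MathematicalPhysics.QuantumManyBody.BoseGas.sideLength ρ M) ∧ ∀ δ : ENNReal, 0 < δ → ∃ φ : Literature.MathematicalPhysics.QuantumManyBody.BoseGas.PeriodicTrialState 1 (Literature.MathematicalPhysics.QuantumManyBody.BoseGas.sideLength ρ M), (∫⁻ X in Literature.MathematicalPhysics.QuantumManyBody.BoseGas.cellN 1 (Literature.MathematicalPhysics.QuantumManyBody.BoseGas.sideLength ρ M), Literature.MathematicalPhysics.QuantumManyBody.BoseGas.kineticDensity φ.ψ X + (∑ j : Fin M, Literature.MathematicalPhysics.QuantumManyBody.BoseGas.periodizedPotential v (Literature.MathematicalPhysics.QuantumManyBody.BoseGas.sideLength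 ρ M) (X 0 - Y j)) * (‖φ.ψ X‖₊ : ENNReal) ^ 2) ≤ (⨅ θ : Literature.MathematicalPhysics.QuantumManyBody.BoseGas.PeriodicTrialState 1 (Literature.MathematicalPhysics.QuantumManyBody.BoseGas.sideLength ρ M), ∫⁻ X in Literature.MathematicalPhysics.QuantumManyBody.BoseGas.cellN 1 (Literature.MathematicalPhysics.QuantumManyBody.BoseGas.sideLength ρ M), Literature.MathematicalPhysics.QuantumManyBody.BoseGas.kineticDensity θ.ψ X + (∑ j : Fin M, Literature.MathematicalPhysics.QuantumManyBody.BoseGas.periodizedPotential v (Literature.MathematicalPhysics.QuantumManyBody.BoseGas.sideLength ρ M) (X 0 - Y j)) * (‖θ.ψ X‖₊ : ENNReal) ^ 2) + δ ∧ ENNReal.ofReal ε < Literature.MathematicalPhysics.QuantumManyBody.BoseGas.condensateOccupation 1 (Literature.MathematicalPhysics.QuantumManyBody.BoseGas.sideLength ρ M) φ.ψ} ≤ ENNReal.ofReal ε * MeasureTheory.volume (Literature.MathematicalPhysics.QuantumManyBody.BoseGas.cellN M (Literature.MathematicalPhysics.QuantumManyBody.BoseGas.sideLength ρ M))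

/-- item stmt-AtomisticToContinuum-14094 · support · rank 9 · closed · proved by Summit.AtomisticToContinuum.BoseEinsteinCondensation.Theorems.responseLiouvilleGlue_proof @ f648441f8c8f (prover) · by planner
[support] GLUE to the target (route-choice repair, reason route.target-unreachable): the two ranked
cruxes of the deciding chain imply the target InsertionResidue — StaticResponseBound (finite
compressibility at every wavelength, ∀ v) and SpaceTimeLiouville (the per-potential engine:
static-response body(v) → insertion-residue body(v)) give InsertionResidue by instantiating the
engine at each admissible v: `fun hK hE v hv => hE v hv (hK v hv)`. Pure logic, provable now
(checked sorry-free in the planner's Sketch.lean, axioms propext/Classical.choice/Quot.sound); it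
only makes explicit in the item graph the edge Crux₂ ∧ Crux₃ → Target that the certified deciding
theorem `closes` already uses inline (`have hX : InsertionResidue := fun w hw => hE w hw (hK w
hw)`). Sources: LiebSeiringerSolovejYngvason2005 (target), route header §Assembly. [difficulty:
provable-now] -/
@[route_item "route-AtomisticToContinuum-BECBathMassLiouville", crux]
def ResponseLiouvilleGlue : Prop :=
  StaticResponseBound → SpaceTimeLiouville → InsertionResidue

/-- item stmt-AtomisticToContinuum-14388 · support · rank 9 · closed · proved by Summit.AtomisticToContinuum.BoseEinsteinCondensation.Theorems.ResidueCondensesAll_proof (prover) · by planner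
sources: LiebSeiringerSolovejYngvason2005, PenroseOnsager1956, Fournais2020
[support] per-potential residue ⇒ torus BEC, this route's OWN row (replaces the shared stmt-12059
here — refuter objection F2a on stmt-13800: 12059's hypothesis `InsertionResidue` denotes the ∃Θ∀Ψ
target stmt-12056 in route BECInsertionCorrector but the ∀Θ∀Ψ target stmt-13800 in this route, one
ledger row with two meanings; the reordered per-v currying makes this a distinct signature on
purpose): for every repulsive finite-range v, InsertionResidue (instantiated at v) gives
constant-mode BEC of δ-near-minimisers of the periodic N-body energy on the torus of side
(N/ρ)^(1/3) for ρ < ρ₀(v) — verbatim the PeriodicBEC body (stmt-0826) that BoundaryTransferWeak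
(stmt-0827) consumes. Proof sketch: given an (N+1)-body δ-near-minimiser Ψ on the torus of side L =
((N+1)/ρ)^(1/3), PICK an N-body δ-near-minimiser Θ on the same torus (PeriodicTrialState N L is
inhabited by the constant state L^(−3N/2), L > 0; if E₀^per(N,L) < ⊤ use the iInf property of
periodicGroundStateEnergy = ⨅ periodicEnergy with δ > 0, if E₀ = ⊤ any Θ), unfold
condensateOccupation (N+1) L Ψ = (N+1)L⁻³∫_(cell^N)|∫_cell Ψ(x,Y)dx|²dY (constantMode, cell
indicators), Cauchy–Schwarz against the normalised Θ: ≥ (N+1)L⁻³|overla -/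
@[route_item "route-AtomisticToContinuum-BECBathMassLiouville", crux]
def ResidueCondensesAll : Prop :=
  ∀ v : ℝ → ENNReal, Literature.MathematicalPhysics.QuantumManyBody.BoseGas.IsRepulsiveFiniteRange v → InsertionResidue → ∃ ρ₀ : ℝ, 0 < ρ₀ ∧ ∀ ρ : ℝ, 0 < ρ → ρ < ρ₀ → ∃ c : ℝ, 0 < c ∧ ∀ᶠ N : ℕ in Filter.atTop, ∃ δ : ENNReal, 0 < δ ∧ ∀ Ψ : Literature.MathematicalPhysics.QuantumManyBody.BoseGas.PeriodicTrialState N (Literature.MathematicalPhysics.QuantumManyBody.BoseGas.sideLength ρ N), Literature.MathematicalPhysics.QuantumManyBody.BoseGas.periodicEnergy v Ψ ≤ Literature.MathematicalPhysics.QuantumManyBody.BoseGas.periodicGroundStateEnergy v N (Literature.MathematicalPhysics.QuantumManyBody.BoseGas.sideLength ρ N) + δ → ENNReal.ofReal (c * N) ≤ Literature.MathematicalPhysics.QuantumManyBody.BoseGas.condensateOccupation N (Literature.MathematicalPhysics.QuantumManyBody.BoseGas.sideLength ρ N) Ψ.ψ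

-- earlier Assembly (stmt-AtomisticToContinuum-13804, replaced 2026-08-16T03:21:22Z -> stmt-AtomisticToContinuum-14387): retired by None — StaticResponseBound → SpaceTimeLiouville → ResidueCondenses → BoundaryTransferWeak → BoseEinsteinCondensation
/-- item stmt-AtomisticToContinuum-14387 · assembly · rank 1 · closed · proved by Summit.AtomisticToContinuum.BoseEinsteinCondensation.Theorems.becBathMassLiouville_assembly_proof (prover) · by planner
sources: LiebSeiringerSolovejYngvason2005, PenroseOnsager1956
[assembly] StaticResponseBound → SpaceTimeLiouville → ResponseLiouvilleGlue → ResidueCondensesAll →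
BoundaryTransferWeak → BoseEinsteinCondensation (the sub-problem Statement, by name); inhabited by
`closes`. -/
@[route_item "route-AtomisticToContinuum-BECBathMassLiouville"]
def Assembly : Prop :=
  StaticResponseBound → SpaceTimeLiouville → ResponseLiouvilleGlue → ResidueCondensesAll → BoundaryTransferWeak → BoseEinsteinCondensation

/-! D-0027 §2.1 — DECIDING THEOREM (planner-authored via `route open/edit --closes-file`; by planner-rbadge-AtomisticToContinuum-BECBathMas-88e6fec2-0 2026-08-16T03:21:22Z):
its hypotheses are this route's items and its conclusion the sub-problem Statement (glue_lint), and it elaborates with this file. -/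

@[closes "route-AtomisticToContinuum-BECBathMassLiouville"] theorem closes (hK : StaticResponseBound) (hE : SpaceTimeLiouville) (hG : ResponseLiouvilleGlue)
    (hR : ResidueCondensesAll) (hT : BoundaryTransferWeak) : BoseEinsteinCondensation :=
  -- badge-repair rev (rbadge-…-88e6fec2): the chain runs through the named glue item
  -- ResponseLiouvilleGlue (Crux₂ ∧ Crux₃ → Target, stmt-14094) and this route's own per-potential
  -- ResidueCondensesAll (Target → constant-mode torus BEC for each v), then the shared transfer (stmt-0827).
  fun v hv => hT v hv (hR v hv (hG hK hE))

end Summit.AtomisticToContinuum.BoseEinsteinCondensation.Theses.BECBathMassLiouville
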